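import Summits.Ventures.YMGap.FlowData.RectTubeElecSumMoments
import HarnessLib

/-!
# Venture YMGap, track Y3 FLOW-DATA — the three moments of the one-step exponent `Φ_ζ = ½ M_ζ(a) + ½ M_ζ(b) + elec(a,E,b)`
# of the (twisted) rectangular tube in terms of the one-slice magnetic sum `M_ζ = magTw_ζ` (theorems only)

HONEST FRAMING: venture file of the cell `pub-ymgap` (QuantumFields programme), track Y3 (FLOW-DATA); companion THEOREMS for
`FlowData/RectTubeElecSumMoments.lean`.  Finite rectangular tube, compact second-countable `G` with probability Haar measure,
continuous `ρ` with `∫ Re tr ρ(C g D) dg = 0` for all `C, D` (no invariant vector), ANY plaquette field `ζ`: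

* `rowMean_stepExponent_eq` — `∫_b∫_E Φ_ζ(a,E,b) = M_ζ(a)/2 + E[M_ζ]/2`;
* `mean_stepExponent_eq` — `m₁ = E[M_ζ]`; `rowVariance_stepExponent_eq` — `V = ¼ Var M_ζ`;
* `sqMean_stepExponent_eq` — `m₂ = ½ E[M_ζ²] + ½ E[M_ζ]² + E[elec²]`.

These feed the second-order strong-coupling law of `E_mag` (`FlowData/RectTubeMagneticSecondOrderLaw.lean`).  Nothing about
`L → ∞`, the continuum or a mass gap; no FLOW-TABLE number.

References: I. Montvay, G. Münster (1994) §3.2.6 [cite: MontvayMunster1994, §3.2.6]; T. Kato (1966) §II.2 [cite: Kato1966, §II.2].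
-/

noncomputable section

open scoped BigOperators ENNReal InnerProductSpace
open MeasureTheory Filter Function Topology
open Literature.MathematicalPhysics.QuantumFieldTheory Literature.Analysis.OperatorTheory
open Literature.MathematicalPhysics.QuantumLattice (RectTorusSite fundamentalRep continuous_fundamentalRep
  fundamentalRep_mem_unitaryGroup)
open Literature.Barriers.QuantumFields
open Summit.Ventures.YMGap.Census (RectPlaquette)

namespace Summit.Ventures.YMGap.FlowData

section Moments

variable {G : Type*} [Group G] [TopologicalSpace G] [IsTopologicalGroup G] [CompactSpace G]
  [MeasurableSpace G] [BorelSpace G] [SecondCountableTopology G] {n k : ℕ} (ρ : G →* Matrix (Fin n) (Fin n) ℂ)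
  (J : ℝ) {Ls : Fin k → ℕ} [∀ i, NeZero (Ls i)]

/-- **Row mean of the one-step exponent**: `∫_b ∫_E Φ_ζ(a,E,b) = M_ζ(a)/2 + E[M_ζ]/2`. [folklore] -/
theorem rowMean_stepExponent_eq (hρ : Continuous ρ)
    (hρ0 : ∀ C D : G, ∫ g, (ρ (C * g * D)).trace.re ∂(haarProbability G) = 0) (ζ : RectPlaquette Ls → G)
    (a : RectSlice Ls G) :
    ∫ b, ∫ E, (rectMagSumTw ρ ζ a / 2 + rectMagSumTw ρ ζ b / 2 + rectElecSum ρ a E b)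
        ∂(Measure.pi fun _ : RectTorusSite Ls => haarProbability G) ∂(rectSliceMeasure G Ls) =
      rectMagSumTw ρ ζ a / 2 + (∫ b, rectMagSumTw ρ ζ b ∂(rectSliceMeasure G Ls)) / 2 := by
  set μE : Measure (RectTorusSite Ls → G) := Measure.pi fun _ : RectTorusSite Ls => haarProbability G with hμE
  set μ : Measure (RectSlice Ls G) := rectSliceMeasure G Ls with hμ
  have hm := continuous_rectMagSumTw ρ (Ls := Ls) hρ ζ
  have hinner : ∀ b, ∫ E, (rectMagSumTw ρ ζ a / 2 + rectMagSumTw ρ ζ b / 2 + rectElecSum ρ a E b) ∂μE =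
      rectMagSumTw ρ ζ a / 2 + rectMagSumTw ρ ζ b / 2 + ∫ E, rectElecSum ρ a E b ∂μE := by
    intro b
    have iel : Integrable (fun E => rectElecSum ρ a E b) μE :=
      (continuous_rectElecSum_links ρ (Ls := Ls) hρ a b).integrable_of_hasCompactSupport
        (HasCompactSupport.of_compactSpace _)
    rw [integral_add (integrable_const _) iel, integral_const, probReal_univ, one_smul]
  simp_rw [hinner]
  have iM : Integrable (fun b => rectMagSumTw ρ ζ b / 2) μ :=
    (hm.div_const 2).integrable_of_hasCompactSupport (HasCompactSupport.of_compactSpace _)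
  have iI : Integrable (fun b => ∫ E, rectElecSum ρ a E b ∂μE) μ := by
    have hc := continuous_rectElecSum_later_links ρ (Ls := Ls) hρ a
    exact (hc.integrable_of_hasCompactSupport (HasCompactSupport.of_compactSpace _)).integral_prod_left
  have i1 : Integrable (fun b => rectMagSumTw ρ ζ a / 2 + rectMagSumTw ρ ζ b / 2) μ := (integrable_const _).add iM
  rw [integral_add i1 iI, integral_add (integrable_const _) iM, integral_const, probReal_univ, one_smul,
    integral_integral_rectElecSum_later_eq_zero ρ hρ hρ0, add_zero]
  rw [integral_div]

/-- **Mean of the one-step exponent**: `m₁ = ∫_a∫_b∫_E Φ_ζ = E[M_ζ]`. [folklore] -/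
theorem mean_stepExponent_eq (hρ : Continuous ρ)
    (hρ0 : ∀ C D : G, ∫ g, (ρ (C * g * D)).trace.re ∂(haarProbability G) = 0) (ζ : RectPlaquette Ls → G) :
    ∫ a, ∫ b, ∫ E, (rectMagSumTw ρ ζ a / 2 + rectMagSumTw ρ ζ b / 2 + rectElecSum ρ a E b)
        ∂(Measure.pi fun _ : RectTorusSite Ls => haarProbability G) ∂(rectSliceMeasure G Ls) ∂(rectSliceMeasure G Ls) =
      ∫ a, rectMagSumTw ρ ζ a ∂(rectSliceMeasure G Ls) := by
  simp_rw [rowMean_stepExponent_eq ρ hρ hρ0 ζ]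
  have hm := continuous_rectMagSumTw ρ (Ls := Ls) hρ ζ
  have iM : Integrable (fun a => rectMagSumTw ρ ζ a / 2) (rectSliceMeasure G Ls) :=
    (hm.div_const 2).integrable_of_hasCompactSupport (HasCompactSupport.of_compactSpace _)
  rw [integral_add iM (integrable_const _), integral_const, probReal_univ, one_smul, integral_div]
  ring

/-- **Row variance of the one-step exponent**: `V = ∫_a (∫_b∫_E Φ_ζ − m₁)² = ¼ ∫ (M_ζ − E[M_ζ])²`. [folklore] -/
theorem rowVariance_stepExponent_eq (hρ : Continuous ρ)
    (hρ0 : ∀ C D : G, ∫ g, (ρ (C * g * D)).trace.re ∂(haarProbability G) = 0) (ζ : RectPlaquette Ls → G) :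
    ∫ a, ((∫ b, ∫ E, (rectMagSumTw ρ ζ a / 2 + rectMagSumTw ρ ζ b / 2 + rectElecSum ρ a E b)
        ∂(Measure.pi fun _ : RectTorusSite Ls => haarProbability G) ∂(rectSliceMeasure G Ls)) -
        ∫ a, ∫ b, ∫ E, (rectMagSumTw ρ ζ a / 2 + rectMagSumTw ρ ζ b / 2 + rectElecSum ρ a E b)
          ∂(Measure.pi fun _ : RectTorusSite Ls => haarProbability G) ∂(rectSliceMeasure G Ls) ∂(rectSliceMeasure G Ls)) ^ 2
        ∂(rectSliceMeasure G Ls) =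
      (1 / 4) * ∫ a, (rectMagSumTw ρ ζ a - ∫ b, rectMagSumTw ρ ζ b ∂(rectSliceMeasure G Ls)) ^ 2 ∂(rectSliceMeasure G Ls) := by
  rw [mean_stepExponent_eq ρ hρ hρ0 ζ]
  simp_rw [rowMean_stepExponent_eq ρ hρ hρ0 ζ]
  rw [← integral_const_mul]
  refine integral_congr_ae (ae_of_all _ fun a => ?_)
  ring

/-- **Mean square of the one-step exponent**: `m₂ = ∫_a∫_b∫_E Φ_ζ² = ½ E[M_ζ²] + ½ E[M_ζ]² + ∫∫∫ elec²` (the cross terms vanish: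
`elec` integrates to zero in either slice). [folklore] -/
theorem sqMean_stepExponent_eq (hρ : Continuous ρ)
    (hρ0 : ∀ C D : G, ∫ g, (ρ (C * g * D)).trace.re ∂(haarProbability G) = 0) (ζ : RectPlaquette Ls → G) :
    ∫ a, ∫ b, ∫ E, (rectMagSumTw ρ ζ a / 2 + rectMagSumTw ρ ζ b / 2 + rectElecSum ρ a E b) ^ 2
        ∂(Measure.pi fun _ : RectTorusSite Ls => haarProbability G) ∂(rectSliceMeasure G Ls) ∂(rectSliceMeasure G Ls) =
      (1 / 2) * (∫ a, rectMagSumTw ρ ζ a ^ 2 ∂(rectSliceMeasure G Ls)) +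
        (1 / 2) * (∫ a, rectMagSumTw ρ ζ a ∂(rectSliceMeasure G Ls)) ^ 2 +
        ∫ a, ∫ b, ∫ E, rectElecSum ρ a E b ^ 2 ∂(Measure.pi fun _ : RectTorusSite Ls => haarProbability G)
          ∂(rectSliceMeasure G Ls) ∂(rectSliceMeasure G Ls) := by
  set μE : Measure (RectTorusSite Ls → G) := Measure.pi fun _ : RectTorusSite Ls => haarProbability G with hμE
  set μ : Measure (RectSlice Ls G) := rectSliceMeasure G Ls with hμ
  set M : RectSlice Ls G → ℝ := rectMagSumTw ρ ζ with hM
  have hm : Continuous M := continuous_rectMagSumTw ρ (Ls := Ls) hρ ζ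
  have cintE : ∀ {f : (RectTorusSite Ls → G) → ℝ}, Continuous f → Integrable f μE :=
    fun hf => hf.integrable_of_hasCompactSupport (HasCompactSupport.of_compactSpace _)
  have cintS : ∀ {f : RectSlice Ls G → ℝ}, Continuous f → Integrable f μ :=
    fun hf => hf.integrable_of_hasCompactSupport (HasCompactSupport.of_compactSpace _)
  have cintSE : ∀ {f : RectSlice Ls G × (RectTorusSite Ls → G) → ℝ}, Continuous f → Integrable f (μ.prod μE) :=
    fun hf => hf.integrable_of_hasCompactSupport (HasCompactSupport.of_compactSpace _)
  have cintSSE : ∀ {f : (RectSlice Ls G × RectSlice Ls G) × (RectTorusSite Ls → G) → ℝ}, Continuous f →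
      Integrable f ((μ.prod μ).prod μE) :=
    fun hf => hf.integrable_of_hasCompactSupport (HasCompactSupport.of_compactSpace _)
  -- Step 1: the `E`-integral of the square, row by row
  have hE : ∀ a b, ∫ E, (M a / 2 + M b / 2 + rectElecSum ρ a E b) ^ 2 ∂μE =
      (M a / 2 + M b / 2) ^ 2 + 2 * (M a / 2 + M b / 2) * (∫ E, rectElecSum ρ a E b ∂μE) +
        ∫ E, rectElecSum ρ a E b ^ 2 ∂μE := by
    intro a b
    have hel := continuous_rectElecSum_links ρ (Ls := Ls) hρ a b
    have iel : Integrable (fun E => rectElecSum ρ a E b) μE := cintE hel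
    have iel2 : Integrable (fun E => rectElecSum ρ a E b ^ 2) μE := cintE (hel.pow 2)
    have ic : Integrable (fun E => 2 * (M a / 2 + M b / 2) * rectElecSum ρ a E b) μE := iel.const_mul _
    have i12 : Integrable (fun E => (M a / 2 + M b / 2) ^ 2 + 2 * (M a / 2 + M b / 2) * rectElecSum ρ a E b) μE :=
      (integrable_const _).add ic
    have hexp : ∀ E, (M a / 2 + M b / 2 + rectElecSum ρ a E b) ^ 2 =
        (M a / 2 + M b / 2) ^ 2 + 2 * (M a / 2 + M b / 2) * rectElecSum ρ a E b + rectElecSum ρ a E b ^ 2 := fun E => by ring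
    simp_rw [hexp]
    rw [integral_add i12 iel2, integral_add (integrable_const _) ic, integral_const_mul, integral_const, probReal_univ,
      one_smul]
  simp_rw [hE]
  -- the row integral of `elec` over the temporal links: bounded and jointly measurable
  have hel3 : Continuous fun z : (RectSlice Ls G × RectSlice Ls G) × (RectTorusSite Ls → G) =>
      rectElecSum ρ z.1.1 z.2 z.1.2 := continuous_rectElecSum ρ (Ls := Ls) hρ
  have hIm : StronglyMeasurable (uncurry fun a b : RectSlice Ls G => ∫ E, rectElecSum ρ a E b ∂μE) :=
    MeasureTheory.StronglyMeasurable.integral_prod_right' (ν := μE) hel3.stronglyMeasurable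
  obtain ⟨CE, hCE⟩ : ∃ C, ∀ z : (RectSlice Ls G × RectSlice Ls G) × (RectTorusSite Ls → G),
      ‖rectElecSum ρ z.1.1 z.2 z.1.2‖ ≤ C := by
    obtain ⟨C, hC⟩ := isCompact_univ.exists_bound_of_continuousOn hel3.continuousOn
    exact ⟨C, fun z => hC z (Set.mem_univ _)⟩
  have hIb : ∀ a b, ‖∫ E, rectElecSum ρ a E b ∂μE‖ ≤ CE := fun a b => by
    have h := norm_integral_le_of_norm_le_const (μ := μE) (f := fun E => rectElecSum ρ a E b) (C := CE)
      (ae_of_all _ fun E => hCE ((a, b), E))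
    rwa [probReal_univ, mul_one] at h
  obtain ⟨CM, hCM⟩ : ∃ C, ∀ a : RectSlice Ls G, ‖M a‖ ≤ C := by
    obtain ⟨C, hC⟩ := isCompact_univ.exists_bound_of_continuousOn hm.continuousOn
    exact ⟨C, fun a => hC a (Set.mem_univ _)⟩
  -- `∫_a I(a,b) da = 0` and `∫_b I(a,b) db = 0` for the row integral `I(a,b) = ∫_E elec`
  have hIa : ∀ b, ∫ a, ∫ E, rectElecSum ρ a E b ∂μE ∂μ = 0 := fun b => by
    have h := integral_integral_mul_rectElecSum_earlier_eq_zero ρ (Ls := Ls) hρ hρ0 b (f := fun _ => (1 : ℝ)) continuous_const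
    simpa only [one_mul] using h
  have hIb0 : ∀ a, ∫ b, ∫ E, rectElecSum ρ a E b ∂μE ∂μ = 0 := fun a =>
    integral_integral_rectElecSum_later_eq_zero ρ hρ hρ0 a
  -- Step 2: the `b`-integral of each row
  have hrow : ∀ a, ∫ b, ((M a / 2 + M b / 2) ^ 2 + 2 * (M a / 2 + M b / 2) * (∫ E, rectElecSum ρ a E b ∂μE) +
      ∫ E, rectElecSum ρ a E b ^ 2 ∂μE) ∂μ =
      (M a ^ 2 / 4 + M a / 2 * (∫ b, M b ∂μ) + (∫ b, M b ^ 2 ∂μ) / 4) + ∫ b, M b * (∫ E, rectElecSum ρ a E b ∂μE) ∂μ +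
        ∫ b, ∫ E, rectElecSum ρ a E b ^ 2 ∂μE ∂μ := by
    intro a
    have hIma : Measurable fun b => ∫ E, rectElecSum ρ a E b ∂μE :=
      measurable_curry_of_uncurry (fun a b : RectSlice Ls G => ∫ E, rectElecSum ρ a E b ∂μE) hIm a
    have iIa : Integrable (fun b => ∫ E, rectElecSum ρ a E b ∂μE) μ :=
      Integrable.of_bound hIma.aestronglyMeasurable CE (ae_of_all _ fun b => hIb a b)
    have iMI : Integrable (fun b => M b * ∫ E, rectElecSum ρ a E b ∂μE) μ :=
      Integrable.of_bound ((hm.measurable.mul hIma).aestronglyMeasurable) (CM * CE) (ae_of_all _ fun b => by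
          rw [norm_mul]; exact mul_le_mul (hCM b) (hIb a b) (norm_nonneg _) ((norm_nonneg _).trans (hCM b)))
    have isq : Integrable (fun b => (M a / 2 + M b / 2) ^ 2) μ := cintS ((continuous_const.add (hm.div_const 2)).pow 2)
    have iW : Integrable (fun b => ∫ E, rectElecSum ρ a E b ^ 2 ∂μE) μ := by
      have hc : Continuous fun z : RectSlice Ls G × (RectTorusSite Ls → G) => rectElecSum ρ a z.2 z.1 ^ 2 :=
        (continuous_rectElecSum_later_links ρ (Ls := Ls) hρ a).pow 2
      exact (cintSE hc).integral_prod_left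
    have hcross : ∀ b, 2 * (M a / 2 + M b / 2) * (∫ E, rectElecSum ρ a E b ∂μE) =
        M a * (∫ E, rectElecSum ρ a E b ∂μE) + M b * (∫ E, rectElecSum ρ a E b ∂μE) := fun b => by ring
    simp_rw [hcross]
    have iIaM : Integrable (fun b => M a * (∫ E, rectElecSum ρ a E b ∂μE)) μ := iIa.const_mul _
    have icross : Integrable (fun b => M a * (∫ E, rectElecSum ρ a E b ∂μE) + M b * (∫ E, rectElecSum ρ a E b ∂μE)) μ :=
      iIaM.add iMI
    have isc : Integrable (fun b => (M a / 2 + M b / 2) ^ 2 +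
        (M a * (∫ E, rectElecSum ρ a E b ∂μE) + M b * (∫ E, rectElecSum ρ a E b ∂μE))) μ := isq.add icross
    rw [integral_add isc iW, integral_add isq icross, integral_add iIaM iMI, integral_const_mul,
      hIb0 a, mul_zero, zero_add]
    congr 1
    congr 1
    -- the pure magnetic part
    have hexp : ∀ b, (M a / 2 + M b / 2) ^ 2 = M a ^ 2 / 4 + M a / 2 * M b + M b ^ 2 / 4 := fun b => by ring
    simp_rw [hexp]
    have i1 : Integrable (fun b => M a / 2 * M b) μ := (cintS hm).const_mul _
    have i2 : Integrable (fun b => M b ^ 2 / 4) μ := (cintS (hm.pow 2)).div_const _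
    have i01 : Integrable (fun b => M a ^ 2 / 4 + M a / 2 * M b) μ := (integrable_const _).add i1
    rw [integral_add i01 i2, integral_add (integrable_const _) i1, integral_const, probReal_univ,
      one_smul, integral_const_mul, integral_div]
  simp_rw [hrow]
  -- Step 3: the `a`-integral
  have hmeasQ : Measurable (uncurry fun a b : RectSlice Ls G => M b * ∫ E, rectElecSum ρ a E b ∂μE) :=
    (hm.measurable.comp measurable_snd).mul hIm.measurable
  have hintQ : Integrable (uncurry fun a b : RectSlice Ls G => M b * ∫ E, rectElecSum ρ a E b ∂μE) (μ.prod μ) :=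
    Integrable.of_bound hmeasQ.aestronglyMeasurable (CM * CE) (ae_of_all _ fun z => by
      simp only [uncurry]
      rw [norm_mul]; exact mul_le_mul (hCM z.2) (hIb z.1 z.2) (norm_nonneg _) ((norm_nonneg _).trans (hCM z.2)))
  have iQ : Integrable (fun a => ∫ b, M b * (∫ E, rectElecSum ρ a E b ∂μE) ∂μ) μ := hintQ.integral_prod_left
  have hQ : ∫ a, ∫ b, M b * (∫ E, rectElecSum ρ a E b ∂μE) ∂μ ∂μ = 0 := by
    rw [integral_integral_swap hintQ]
    simp_rw [integral_const_mul, hIa, mul_zero]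
    rw [integral_zero]
  have iW2 : Integrable (fun a => ∫ b, ∫ E, rectElecSum ρ a E b ^ 2 ∂μE ∂μ) μ := by
    have hc : Continuous fun z : (RectSlice Ls G × RectSlice Ls G) × (RectTorusSite Ls → G) =>
        rectElecSum ρ z.1.1 z.2 z.1.2 ^ 2 := hel3.pow 2
    have h1 : Integrable (fun p : RectSlice Ls G × RectSlice Ls G => ∫ E, rectElecSum ρ p.1 E p.2 ^ 2 ∂μE) (μ.prod μ) :=
      (cintSSE hc).integral_prod_left
    exact h1.integral_prod_left
  have ipoly : Integrable (fun a => M a ^ 2 / 4 + M a / 2 * (∫ b, M b ∂μ) + (∫ b, M b ^ 2 ∂μ) / 4) μ :=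
    (((cintS (hm.pow 2)).div_const _).add (cintS ((hm.div_const 2).mul continuous_const))).add (integrable_const _)
  have ipq : Integrable (fun a => M a ^ 2 / 4 + M a / 2 * (∫ b, M b ∂μ) + (∫ b, M b ^ 2 ∂μ) / 4 +
      ∫ b, M b * (∫ E, rectElecSum ρ a E b ∂μE) ∂μ) μ := ipoly.add iQ
  rw [integral_add ipq iW2, integral_add ipoly iQ, hQ, add_zero]
  congr 1
  have i1 : Integrable (fun a => M a ^ 2 / 4) μ := (cintS (hm.pow 2)).div_const _
  have i2 : Integrable (fun a => M a / 2 * ∫ b, M b ∂μ) μ := cintS ((hm.div_const 2).mul continuous_const)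
  have i12 : Integrable (fun a => M a ^ 2 / 4 + M a / 2 * ∫ b, M b ∂μ) μ := i1.add i2
  rw [integral_add i12 (integrable_const _), integral_add i1 i2, integral_const, probReal_univ, one_smul,
    integral_div, integral_mul_const, integral_div]
  ring

end Moments

end Summit.Ventures.YMGap.FlowData
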